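import Literature.MathematicalPhysics.QuantumFieldTheory.Balaban1983to89.Node00.RateRecordW1Reading

/-!
# NODE 00 — THE ALL-RUNS PACKAGING OF A W1 RATE READING: node U3's objects of ONE construction on ONE carrier holding the localization domains of EVERY
# run length (`ReadingData.allRunsCarriers ∕ allRunsEA ∕ allRunsEB ∕ u3ObjectsAllRuns`), and the `∀ K` dictionary to the per-run-length levels
# `ReadingData.u3Objects` ([Balaban1987RG1] (0.24)–(0.25) p. 257, (1.18)–(1.22) pp. 263–264: the recipe (1.20)–(1.22) reads `β_{j+1}` off the terms `E^{(j+1)}` in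
# the limit `T^{(j+1)} ↗ Z^d`, i.e. off the terms of ALL sufficiently long runs — bookkeeping of that quantifier, nothing asserted)

Cell `pub-ymgap`, width seat `pub-ymgap-dag-n18-w2` (HUMAN RULING D-0149 ∕ director-ym №197; plan g77 `W-SEAT-START-LIST` v3 §n18 ITEM 2 «NON-ZERO U3 OBJECT TOWER of
record over the record's boxes»), in the definer lane's HOME `Node00/` next to node00-def-W1's `RateRecordW1Reading` (the per-run-length reading `ReadingData.u3Objects`)
— ONE new object, hypothesis-schema style: total definitions, `rfl` ∕ `Iff` faces; nothing of Bałaban's asserted; `--supports stmt-QuantumFields-20544` (K3⁷), count-neutral.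

WHY (located finding of this seat's `Summits/…/Theorems/BalabanUVNodesN18U3TowerGuards.lean` §3, kernel-checked).  The (D4) read-out binder of the K4 cluster
(`YMDAG.UVSplit.ReadOutAt`, built on `T4BetaReadOut.RepresentsA ∕ RepresentsB`) reads EVERY step `β_{k′+1}` of the datum's β off the frozen-coupling slices of ONE
node-U3 functional.  Keyed at a run-length-`k` level of a W1 reading at RUN TOWERS (`W1.runTowers`: the run of `k` steps creates the terms of steps `1,…,k` and no
others, [I] (0.23)) it forces the datum's β at every step `k′ ≥ k` to be blind to `g_k,…,g_{k′}` (at `k = 0`: constant on every box) — because the level-`k`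
functional sees the couplings below `k` only.  The (D4)-compatible node-U3 object is therefore NOT a run-length level but a functional on ONE carrier that holds the
creation steps of EVERY run: exactly the shape of the cell's witness `T4BetaReadOutWitness.toyC` (domains at all scales) and of print's recipe (the `K`-family of
finite-volume kernels, `Node00.BetaOfRecord.polLimit … = limUnder atTop (K ↦ …)`).  THIS FILE types that object for an arbitrary W1 reading `D : ReadingData F 𝔸 M`:
* §1 `D.allRunsCarriers` — `Dom := Σ K, W1.Dom (F.P K) M` (the domain `(j, X)` of run `K`), `scale ⟨K,(j,X)⟩ := j`, `d := d_j(X)` of run `K`'s torus, backgrounds := a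
  background for EVERY run (`Π K, (D.pairing K).BgA`, `Π K, (D.pairing K).BgB`), transport componentwise; the closeness GAUGE is set to `0` — a JUNK VALUE, SAID SO: no
  slot of the K4 cluster's node U3 (`N17At ∕ N18At ∕ N22At ∕ ReadOutAt`) reads `Carriers.gauge` (it serves NE3 ∕ `BackgroundsClose` consumers, which read W1's per-run
  gauges `(D.pairing K).gauge` directly); `D.allRunsEA g U ⟨K,(j,X)⟩ := (D.pairing K).EA (D.S K) g (U K) (j,X)` = `Re E^{(j)}(X; g; embA (U K))` of run `K`,
  `D.allRunsEB b g U ⟨K,X⟩ := (D.pairing K).EB (D.S (K+1)) b g (U K) X`; `D.u3ObjectsAllRuns γ := U3Objects₁₁.ofFixed D.allRunsCarriers D.allRunsEA D.allRunsEB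
  (D.li.analytic γ)` (RR-1's fixed-carrier constructor: the SAME all-runs object at every level index, so a run-length selector is idle on it).
* §2 FACES (`rfl`): `allRunsEA_apply ∕ allRunsEB_apply` (= the level-`K` functionals of `D.u3Objects γ` at the `K`-component), `u3ObjectsAllRuns_levelCarriers ∕ _EA ∕ _EB ∕
  _toU3Letters₁₁`, `u3ObjectsAllRuns_populated` (unconditional), `prefixDependenceOn_allRunsEA` ∕ `scaleZeroFree_allRunsEA` (no hypothesis).
* §3 THE `∀ K` DICTIONARY (kernel): given a background for every run (`∀ K, Nonempty (D.pairing K).BgB` resp. `.BgA` — true for the run sides of record, gauge fields),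
  `ne5_allRuns_iff` — `NE5 D.allRunsEA (D.allRunsEB b) W κ θ C₅ ↔ ∀ K, NE5 ((D.u3Objects γ).EA K) ((D.u3Objects γ).EB K b) W κ θ C₅` (same letters at every run length:
  the K-UNIFORM reading RR-1's letter block types); `ne9_allRuns_iff`; `decayBound_allRuns_iff`; the unconditional halves `ne5_allRuns_of_forall` … need no inhabitant.
  So N18 ∕ N22 AT THE ALL-RUNS OBJECT are the per-level statements FOR EVERY RUN LENGTH AT ONCE — nothing is lost or added — while (D4) becomes keyable without
  degenerating β (its recipe may read the slice's components at the runs `K > k′`).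

HONEST FRAMING.  A PACKAGING of W1's residual reading data (the towers `D.S K` — the VALUES of the (2.14) terms — stay residual inputs exactly as in
`RateRecordW1Reading`; N10's objects are not instantiated); the gauge field of the carrier is junk `0` (above); nothing of Bałaban's is asserted; NE5 ∕ NE9 ∕ (D4) are
NOT PRINTED for d = 4 beyond [I] (1.20)–(1.22)'s linearity and NOT proved; no node discharged; counts UNMOVED (typed 28∕28 · discharged 5∕27 (A 5∕28)); K3⁷ OPEN.  One
finite four-torus programme at fixed `ε`, Bałaban as printed — NOT ℝ⁴, NOT infinite volume, NOT OS, NOT a mass gap, NOT Clay.  No `sorry`, no `instance`, no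
`notation`; `Summits/` is not imported.
-/

noncomputable section

open scoped BigOperators

namespace Literature.MathematicalPhysics.QuantumFieldTheory.Balaban1983to89.Node00

open Literature.MathematicalPhysics.QuantumFieldTheory.Balaban1983to89
open T4Continuum Sect2
open Literature.MathematicalPhysics.QuantumFieldTheory.Balaban1983to89.T4OutputRate (Carriers Functional Window NE5 NE9 DecayBound PrefixDependenceOn)
open Literature.MathematicalPhysics.QuantumFieldTheory.Balaban1983to89.T4HistoryLipschitzRecursion (ScaleZeroFree)

namespace W1

namespace ReadingData

variable {F : T4Family} {𝔸 : Type*} {M : ℕ} (D : ReadingData F 𝔸 M) (γ : ℝ)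

/-! ## §1  The all-runs carriers, functionals and U3 objects of a W1 reading -/

/-- **THE ALL-RUNS CARRIERS OF THE READING**: ONE index type holding the localization domains `(j, X)` of EVERY run length `K` (`Σ K, W1.Dom (F.P K) M`), creation step
and tree length those of run `K`'s torus catalogue; a background for every run on both sides (`Π K`), the one-step transports componentwise.  The closeness gauge is
the JUNK VALUE `0` (node U3's K4 slots never read `Carriers.gauge`; NE3 consumers read the per-run gauges `(D.pairing K).gauge`).
[cite: Balaban1987RG1, (0.24)-(0.25) p.257 and (1.21) p.264 (the β-recipe reads the terms of all runs; bookkeeping)] -/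
def allRunsCarriers : Carriers where
  Dom := Σ K : ℕ, W1.Dom (F.P K) M
  scale := fun X => X.2.1
  d := fun X => (domSys (F.P X.1) M X.2.1).dj X.2.2
  d_nonneg := fun X => (domSys (F.P X.1) M X.2.1).dj_nonneg X.2.2
  BgA := (K : ℕ) → (D.pairing K).BgA
  BgB := (K : ℕ) → (D.pairing K).BgB
  gauge := fun _ _ => 0
  gauge_nonneg := fun _ _ => le_rfl
  transport := fun U K => (D.pairing K).transport (U K)

/-- **RUN A's ALL-RUNS FUNCTIONAL**: at the domain `(j, X)` of run `K`, the level-`K` functional of the reading at the `K`-component of the background —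
`Re E^{(j)}(X; g₀,…,g_{j−1}; embA (U K))`, (2.13) of the tower `D.S K`. [cite: Balaban1988RG2Cluster, (2.13) p.14; Balaban1987RG1, (0.24) p.257 and (1.18) p.263] -/
def allRunsEA : Functional D.allRunsCarriers ((K : ℕ) → (D.pairing K).BgA) :=
  fun g U X => (D.pairing X.1).EA (D.S X.1) g (U X.1) X.2

/-- **RUN B's ALL-RUNS FIRST-COUPLING FAMILY**: at the domain `(j, X)` of run `K`, the level-`K` family of the reading (run `K + 1`'s tower at the paired domain, the
unpaired first coupling `b` prepended) at the `K`-component of the run-B background. [cite: Balaban1988RG2Cluster, (2.13) p.14; Balaban1987RG1, (0.24)-(0.25) p.257] -/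
def allRunsEB : ℝ → Functional D.allRunsCarriers ((K : ℕ) → (D.pairing K).BgB) :=
  fun b g U X => (D.pairing X.1).EB (D.S (X.1 + 1)) b g (U X.1) X.2

/-- **THE ALL-RUNS U3 OBJECTS OF THE READING** at window radius `γ`: RR-1's FIXED-CARRIER objects `U3Objects₁₁.ofFixed` on the all-runs carriers with the all-runs
functionals and the analytic letter block of the inputs — the SAME object at every level index (a run-length selector is idle on it).
[cite: Balaban1987RG1, (0.24)-(0.25) p.257 and (1.18)-(1.22) pp.263-264 (objects only)] -/
def u3ObjectsAllRuns : U3Objects₁₁ :=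
  U3Objects₁₁.ofFixed D.allRunsCarriers D.allRunsEA D.allRunsEB (D.li.analytic γ)

/-! ## §2  Faces (`rfl`) and the hypothesis-free clauses -/

/-- Face: the domains of the all-runs carriers. [cite: Balaban1987RG1, (0.24) p.257 (bookkeeping)] -/
theorem allRunsCarriers_Dom : D.allRunsCarriers.Dom = (Σ K : ℕ, W1.Dom (F.P K) M) := rfl

/-- Face: the creation step of `⟨K, (j, X)⟩` is `j`. [cite: Balaban1987RG1, (0.24) p.257 (bookkeeping)] -/
@[simp] theorem allRunsCarriers_scale (X : Σ K : ℕ, W1.Dom (F.P K) M) : D.allRunsCarriers.scale X = X.2.1 := rfl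

/-- Face: the tree length of `⟨K, (j, X)⟩` is `d_j(X)` of run `K`'s torus. [cite: Balaban1987RG1, p.257 (d_j(X); bookkeeping)] -/
@[simp] theorem allRunsCarriers_d (X : Σ K : ℕ, W1.Dom (F.P K) M) : D.allRunsCarriers.d X = (domSys (F.P X.1) M X.2.1).dj X.2.2 := rfl

/-- Face: the transport acts componentwise by the level transports. [cite: Balaban1987RG1, §1 p.263 (bookkeeping)] -/
theorem allRunsCarriers_transport (U : (K : ℕ) → (D.pairing K).BgB) (K : ℕ) : D.allRunsCarriers.transport U K = (D.pairing K).transport (U K) := rfl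

/-- Face: the gauge is the junk value `0` (unread by node U3's K4 slots). [cite: Balaban1987RG1, §1 p.263 (bookkeeping; junk value documented)] -/
theorem allRunsCarriers_gauge (U U' : (K : ℕ) → (D.pairing K).BgA) : D.allRunsCarriers.gauge U U' = 0 := rfl

/-- Face: run A's all-runs functional at `⟨K, X⟩` IS the level-`K` functional of the reading at the `K`-component. [cite: Balaban1988RG2Cluster, (2.13) p.14 (bookkeeping)] -/
theorem allRunsEA_apply (g : ℕ → ℝ) (U : (K : ℕ) → (D.pairing K).BgA) (K : ℕ) (X : W1.Dom (F.P K) M) :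
    D.allRunsEA g U ⟨K, X⟩ = (D.u3Objects γ).EA K g (U K) X := rfl

/-- Face: … in W1's term currency, `Re E^{(j)}(X; g; embA (U K))`. [cite: Balaban1988RG2Cluster, (2.13) p.14 (bookkeeping)] -/
theorem allRunsEA_apply_functionalC (g : ℕ → ℝ) (U : (K : ℕ) → (D.pairing K).BgA) (K : ℕ) (X : W1.Dom (F.P K) M) :
    D.allRunsEA g U ⟨K, X⟩ = (functionalC (D.S K) g ((D.pairing K).embA (U K)) X).re := rfl

/-- Face: run B's all-runs family at `⟨K, X⟩` IS the level-`K` family of the reading at the `K`-component. [cite: Balaban1988RG2Cluster, (2.13) p.14 (bookkeeping)] -/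
theorem allRunsEB_apply (b : ℝ) (g : ℕ → ℝ) (U : (K : ℕ) → (D.pairing K).BgB) (K : ℕ) (X : W1.Dom (F.P K) M) :
    D.allRunsEB b g U ⟨K, X⟩ = (D.u3Objects γ).EB K b g (U K) X := rfl

/-- Face: the level carriers of the all-runs objects are the all-runs carriers, at every level index. [cite: Balaban1987RG1, (0.24)-(0.25) p.257 (bookkeeping)] -/
theorem u3ObjectsAllRuns_levelCarriers (k : ℕ) : (D.u3ObjectsAllRuns γ).levelCarriers k = D.allRunsCarriers := rfl

/-- Face: the level functionals of the all-runs objects are the all-runs functional, at every level index. [cite: Balaban1988RG2Cluster, (2.13) p.14 (bookkeeping)] -/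
theorem u3ObjectsAllRuns_EA (k : ℕ) : (D.u3ObjectsAllRuns γ).EA k = D.allRunsEA := rfl

/-- Face: the level families of the all-runs objects are the all-runs family, at every level index. [cite: Balaban1988RG2Cluster, (2.13) p.14 (bookkeeping)] -/
theorem u3ObjectsAllRuns_EB (k : ℕ) : (D.u3ObjectsAllRuns γ).EB k = D.allRunsEB := rfl

/-- Face: the letter block is the analytic block of the inputs (as for `D.u3Objects γ`). [cite: Balaban1987RG1, (1.20)-(1.22) p.264 (bookkeeping)] -/
theorem u3ObjectsAllRuns_toU3Letters₁₁ : (D.u3ObjectsAllRuns γ).toU3Letters₁₁ = D.li.analytic γ := rfl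

/-- The letter blocks of the all-runs objects and of the per-run-length objects AGREE. [cite: Balaban1987RG1, (1.20)-(1.22) p.264 (bookkeeping)] -/
theorem u3ObjectsAllRuns_toU3Letters₁₁_eq : (D.u3ObjectsAllRuns γ).toU3Letters₁₁ = (D.u3Objects γ).toU3Letters₁₁ := rfl

/-- **THE ALL-RUNS OBJECTS ARE POPULATED — UNCONDITIONALLY** (the cube of creation step `0` of run `0`). [cite: Balaban1987RG1, p.257 (the cubes; display of non-degeneracy)] -/
theorem u3ObjectsAllRuns_populated : (D.u3ObjectsAllRuns γ).Populated := by
  intro _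
  obtain ⟨X⟩ := D.u3Objects_populated γ 0
  exact ⟨⟨0, X⟩⟩

/-- **(P) FOR THE ALL-RUNS FUNCTIONAL — NO HYPOTHESIS**: the term at `⟨K, (j, X)⟩` reads `g₀,…,g_{j−1}` only. [cite: Balaban1987RG1, §0 p.256 and §5 p.298] -/
theorem prefixDependenceOn_allRunsEA (W : Set (ℕ → ℝ)) : PrefixDependenceOn D.allRunsEA W := by
  rintro g hg g' hg' U ⟨K, X⟩ h
  exact functionalOn_prefixDependenceOn (D.S K) (D.pairing K).toRunPairing (D.pairing K).embA W g hg g' hg' (U K) X h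

/-- No term at creation step `0`, for the all-runs functional. [cite: Balaban1987RG1, (0.23) p.256] -/
theorem scaleZeroFree_allRunsEA (W : Set (ℕ → ℝ)) : ScaleZeroFree D.allRunsEA W := by
  rintro g hg g' hg' U ⟨K, X⟩ h
  exact functionalOn_scaleZeroFree (D.S K) (D.pairing K).toRunPairing (D.pairing K).embA W g hg g' hg' (U K) X h

/-! ## §3  The `∀ K` dictionary: NE5 ∕ NE9 ∕ the decay bound at the all-runs object ARE the per-run-length statements at every run length -/

/-- NE5 at every run length gives NE5 at the all-runs object (no inhabitant needed). [cite: Balaban1987RG1, Thm 1 p.259 and (1.18) p.263 (NE5 is NOT printed; bookkeeping)] -/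
theorem ne5_allRuns_of_forall {b : ℝ} {W : Set (ℕ → ℝ)} {κ θ C₅ : ℝ}
    (h : ∀ K, NE5 ((D.u3Objects γ).EA K) ((D.u3Objects γ).EB K b) W κ θ C₅) : NE5 D.allRunsEA (D.allRunsEB b) W κ θ C₅ := by
  rintro g hg U ⟨K, X⟩
  exact h K g hg (U K) X

/-- **NE5 AT THE ALL-RUNS OBJECT IS NE5 AT EVERY RUN LENGTH** (same letters), given a run-B background for every run (to extend one component to a `Π`-background;
the run sides of record are gauge-field types, inhabited). [cite: Balaban1987RG1, Thm 1 p.259 and (1.18) p.263 (NE5 is NOT printed; bookkeeping)] -/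
theorem ne5_allRuns_iff (hB : ∀ K, Nonempty (D.pairing K).BgB) (b : ℝ) (W : Set (ℕ → ℝ)) (κ θ C₅ : ℝ) :
    NE5 D.allRunsEA (D.allRunsEB b) W κ θ C₅ ↔ ∀ K, NE5 ((D.u3Objects γ).EA K) ((D.u3Objects γ).EB K b) W κ θ C₅ := by
  classical
  refine ⟨fun h K g hg UK X => ?_, D.ne5_allRuns_of_forall γ⟩
  have h' := h g hg (Function.update (fun K' => Classical.choice (hB K')) K UK) ⟨K, X⟩
  dsimp only [allRunsEA, allRunsEB, allRunsCarriers] at h'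
  rw [Function.update_self] at h'
  exact h'

/-- NE9 at every run length gives NE9 at the all-runs functional (no inhabitant needed). [cite: Balaban1987RG1, (1.18) p.263 and §5 p.298 (NE9 is NOT printed; bookkeeping)] -/
theorem ne9_allRuns_of_forall {W : Set (ℕ → ℝ)} {κ : ℝ} {Λ : ℕ → ℕ → ℝ}
    (h : ∀ K, NE9 (C := (D.u3Objects γ).levelCarriers K) ((D.u3Objects γ).EA K) W κ Λ) : NE9 D.allRunsEA W κ Λ := by
  rintro g hg g' hg' U ⟨K, X⟩
  exact h K g hg g' hg' (U K) X

/-- **NE9 AT THE ALL-RUNS FUNCTIONAL IS NE9 AT EVERY RUN LENGTH** (same moduli), given a run-A background for every run.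
[cite: Balaban1987RG1, (1.18) p.263 and §5 p.298 (NE9 is NOT printed; bookkeeping)] -/
theorem ne9_allRuns_iff (hA : ∀ K, Nonempty (D.pairing K).BgA) (W : Set (ℕ → ℝ)) (κ : ℝ) (Λ : ℕ → ℕ → ℝ) :
    NE9 D.allRunsEA W κ Λ ↔ ∀ K, NE9 (C := (D.u3Objects γ).levelCarriers K) ((D.u3Objects γ).EA K) W κ Λ := by
  classical
  refine ⟨fun h K g hg g' hg' UK X => ?_, D.ne9_allRuns_of_forall γ⟩
  have h' := h g hg g' hg' (Function.update (fun K' => Classical.choice (hA K')) K UK) ⟨K, X⟩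
  dsimp only [allRunsEA, allRunsCarriers] at h'
  rw [Function.update_self] at h'
  exact h'

/-- The printed-form decay bound at every run length gives it at the all-runs functional. [cite: Balaban1987RG1, (1.18) p.263] -/
theorem decayBound_allRuns_of_forall {W : Set (ℕ → ℝ)} {E₀ κ : ℝ}
    (h : ∀ K, DecayBound (C := (D.u3Objects γ).levelCarriers K) ((D.u3Objects γ).EA K) W E₀ κ) : DecayBound D.allRunsEA W E₀ κ := by
  rintro g hg U ⟨K, X⟩
  exact h K g hg (U K) X

/-- **THE DECAY BOUND AT THE ALL-RUNS FUNCTIONAL IS THE DECAY BOUND AT EVERY RUN LENGTH**, given a run-A background for every run. [cite: Balaban1987RG1, (1.18) p.263] -/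
theorem decayBound_allRuns_iff (hA : ∀ K, Nonempty (D.pairing K).BgA) (W : Set (ℕ → ℝ)) (E₀ κ : ℝ) :
    DecayBound D.allRunsEA W E₀ κ ↔ ∀ K, DecayBound (C := (D.u3Objects γ).levelCarriers K) ((D.u3Objects γ).EA K) W E₀ κ := by
  classical
  refine ⟨fun h K g hg UK X => ?_, D.decayBound_allRuns_of_forall γ⟩
  have h' := h g hg (Function.update (fun K' => Classical.choice (hA K')) K UK) ⟨K, X⟩
  dsimp only [allRunsEA, allRunsCarriers] at h'
  rw [Function.update_self] at h'
  exact h'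

end ReadingData

end W1

end Literature.MathematicalPhysics.QuantumFieldTheory.Balaban1983to89.Node00

end
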